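/-
Copyright (c) 2025 Kevin Buzzard. All rights reserved.
Released under Apache 2.0 license as described in the file LICENSE.
Authors: Kevin Buzzard, Salvatore Mercuri
-- (for the material from `FLT/Mathlib/Algebra/Algebra/Hom.lean`, `FLT/Mathlib/Algebra/Algebra/Pi.lean`,
--  `FLT/Mathlib/Topology/Algebra/UniformRing.lean`)
Copyright (c) 2026 Salvatore Mercuri. All rights reserved.
Released under Apache 2.0 license as described in the file LICENSE.
Authors: Salvatore Mercuri, Kevin Buzzard
-- (for the material from `FLT/Mathlib/Topology/Algebra/Algebra/Hom.lean`)

Vendored into this tree (Lean v4.32.0 / Mathlib v4.32.0) from the FLT project,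
ImperialCollegeLondon/FLT @ 071d16bb51e87165b4f4b5466f14051344bf426b (2026-08-18), Apache-2.0
[FLTProject2025]. Modifications: see the module docstring ("Provenance and modifications").
-/
import Mathlib.Algebra.Algebra.Pi
import Mathlib.Algebra.Algebra.Prod
import Mathlib.Algebra.BigOperators.Pi
import Mathlib.Topology.Algebra.UniformRing
import Mathlib.Topology.Constructions.SumProd
import HarnessLib

/-!
# Semialgebra homomorphisms `A →ₛₐ[φ] B` and their continuous version `A →SA[φ] B`

Topic `NumberTheory/AdelicBaseChange` — file 2 of the ADELIC BASE-CHANGE PACKET (the FLT project's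
proof of `L ⊗[K] K_v ≃ₐ[L] ∏_{w ∣ v} L_w`, `L ⊗[K] 𝔸_K^∞ ≃ₐ[L] 𝔸_L^∞`, `L ⊗[K] 𝔸_K ≃ₐ[L] 𝔸_L`,
vendored module by module; Cassels–Fröhlich, *Algebraic Number Theory*, Ch. II §10, §14). This file
is pure algebra/topology and independent of the rest of the packet: it is the TYPE in which FLT
states every base-change map. For a ring hom `φ : R →+* S`, an `R`-algebra `A` and an `S`-algebra `B`:

* `SemialgHom φ A B`, notation `A →ₛₐ[φ] B`: ring homs `ψ : A →+* B` with `ψ (r • a) = φ r • ψ a`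
  (simultaneously `φ`-semilinear maps), the class `SemialgHomClass`, composition, products
  `SemialgHom.prod`/`prodMap`, `AlgHom.toSemialgHom`, `RingHom.toSemialgHom`, `restrictScalars`;
* `Pi.semialgHom`, `Pi.semialgHomPi` (families into products), `AlgEquiv.piCongrFiberwise`
  (`Equiv.piCongrFiberwise` as an algebra isomorphism), and the splitting
  `Pi.ringHomEquivOfIsDomain : ((Π i, R i) →+* S) ≃ Σ i, (R i →+* S)` / `Pi.algHomEquivOfIsDomain`
  of homs from a finite product into a domain (`RingHom.piIndex`, `RingHom.projPiIndex`);
* `UniformSpace.Completion.mapSemialgHom`: the completion of a continuous ring hom as a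
  semialgebra hom `Completion α →ₛₐ[f] Completion β`;
* `ContinuousSemialgHom φ A B`, notation `A →SA[φ] B`, with `ContinuousSemialgHomClass`, `prod`,
  `prodMap`.

Everything is PROVED (definitions with bodies + lemmas); no named facts. The STATEMENTS are,
verbatim, those of the published FLT project, so every declaration carries the provenance tag
`[cite: FLTProject2025, <FLT file> · <FLT name>]` (the gate's cited-only rule for `Literature/`);
anonymous instances carry a docstring only. The file declares the four GLOBAL notations
`→ₛₐ`, `→ₛₐ[φ]`, `→SA`, `→SA[φ]` exactly as FLT does (they shadow nothing in Mathlib v4.32.0; the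
later files of the packet use them pervasively, so they are not `scoped`).

## Provenance and modifications (Apache-2.0 §4)

Lean source: `FLT/Mathlib/Algebra/Algebra/Hom.lean`, `FLT/Mathlib/Algebra/Algebra/Pi.lean`,
`FLT/Mathlib/Topology/Algebra/UniformRing.lean`, `FLT/Mathlib/Topology/Algebra/Algebra/Hom.lean` of
ImperialCollegeLondon/FLT at commit `071d16bb51e8` (branch `main`, 2026-08-18; Lean v4.34.0-rc1 /
Mathlib `274ed6d6`), concatenated in import order. Modifications made here: (1) back-port to Mathlib
v4.32.0 — `module`/`public import`/`@[expose] public section` removed (nothing else was needed for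
these four files); (2) FLT's two accidental ROOT names `instFunLike` / `coe_mk` (for `SemialgHom`)
renamed `SemialgHom.instFunLike` / `SemialgHom.coe_mk`; (3) docstrings and provenance tags added
to every declaration; the original copyright headers are kept above; (4) NAMESPACES (CONVENTIONS §2,
review p318962): FLT's ROOT-LEVEL declarations — the structures/classes `SemialgHom`, `SemialgHomClass`,
`ContinuousSemialgHom`, `ContinuousSemialgHomClass` and their API namespaces — are declared in the path
namespace `Literature.NumberTheory.AdelicBaseChange` (so `SemialgHom` is
`Literature.NumberTheory.AdelicBaseChange.SemialgHom`; if Mathlib later absorbs FLT's `SemialgHom` the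
copy here merely becomes redundant), and that namespace is opened at the top of this and every later
packet file, so FLT's text applies unchanged; FLT's deliberate extensions of MATHLIB namespaces
(`AlgHom.toSemialgHom`, `RingHom.toSemialgHom`, `Pi.semialgHom`, `AlgEquiv.piCongrFiberwise`,
`RingHom.piIndex`, `NonUnitalRingHom.single`, `Pi.ringHomEquivOfIsDomain`, …,
`UniformSpace.Completion.mapSemialgHom`) keep their absolute names for dot notation, and each such
docstring says so. Short names are FLT's throughout. None of these names exists in Mathlib v4.32.0 or in
the tree (the tree's only `SemialgHom…` tokens are the unrelated semialgebraic-homeomorphism predicates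
under `Literature/Barriers/KontsevichZagierPeriods` and `Literature/ModelTheory`); the unused imports
`Mathlib.Algebra.Order.AbsoluteValue.Basic`, `Mathlib.Data.Rat.Floor` of FLT's fourth file are dropped.

Dictionary note (FLT-INVENTORY §5.2 T13): the tree states base change with plain `RingHom`s plus
`Algebra`/`IsScalarTower` facts (`Literature/NumberTheory/Automorphic/AdeleBaseChange.lean`);
an `A →ₛₐ[algebraMap K L] B` is exactly such a ring hom together with its `map_smul` law.

## References
* K. Buzzard, R. Taylor et al., *FLT* (Lean 4 project), Imperial College London, 2025–. [FLTProject2025]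
-/

namespace Literature.NumberTheory.AdelicBaseChange
-- the packet namespace (CONVENTIONS §2): FLT-root declarations below live in it; it is opened here so
-- that FLT's cross-references between them and its Mathlib-namespace extensions resolve unchanged.
end Literature.NumberTheory.AdelicBaseChange

open Literature.NumberTheory.AdelicBaseChange

/-! ## From `FLT/Mathlib/Algebra/Algebra/Hom.lean` -/

section semialghom

namespace Literature.NumberTheory.AdelicBaseChange

/-- Let `φ : R →+* S` be a ring homomorphism, let `A` be an `R`-algebra and let `B` be
an `S`-algebra. Then `SemialgHom φ A B` or `A →ₛₐ[φ] B` is the ring homomorphisms `ψ : A →+* B`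
making lying above `φ` (i.e. such that `ψ (r • a) = φ r • ψ a`).
[cite: FLTProject2025, FLT/Mathlib/Algebra/Algebra/Hom.lean · SemialgHom] -/
structure SemialgHom {R S : Type*} [CommSemiring R] [CommSemiring S] (φ : R →+* S)
    (A B : Type*)  [Semiring A] [Semiring B] [Algebra R A] [Algebra S B]
    extends A →ₛₗ[φ] B, RingHom A B

/-- Reinterpret a `SemialgHom` as a `RingHom`. -/
add_decl_doc SemialgHom.toRingHom

@[inherit_doc SemialgHom]
infixr:25 " →ₛₐ " => SemialgHom _

@[inherit_doc]
notation:25 A " →ₛₐ[" φ:25 "] " B:0 => SemialgHom φ A B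

end Literature.NumberTheory.AdelicBaseChange

variable {R S : Type*} [CommSemiring R] [CommSemiring S] (φ : R →+* S)
    (A B : Type*) [Semiring A] [Semiring B] [Algebra R A] [Algebra S B]

namespace Literature.NumberTheory.AdelicBaseChange

/-- `A →ₛₐ[φ] B` is a type of functions `A → B`.
[cite: FLTProject2025, FLT/Mathlib/Algebra/Algebra/Hom.lean · SemialgHom.instFunLike] -/
instance SemialgHom.instFunLike : FunLike (A →ₛₐ[φ] B) A B where
  coe f := f.toFun
  coe_injective f g h := by
    cases f
    cases g
    congr
    exact DFunLike.coe_injective h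

variable {φ} {A} {B} in
/-- A `φ`-semialgebra homomorphism `ψ` satisfies `ψ (m • x) = φ m • ψ x`.
[cite: FLTProject2025, FLT/Mathlib/Algebra/Algebra/Hom.lean · SemialgHom.map_smul] -/
lemma SemialgHom.map_smul (ψ : A →ₛₐ[φ] B) (m : R) (x : A) : ψ (m • x) = φ m • ψ x :=
  LinearMap.map_smul' ψ.toLinearMap m x

/-- The function underlying the semialgebra hom built from a semilinear map `f` is `f`.
[cite: FLTProject2025, FLT/Mathlib/Algebra/Algebra/Hom.lean · SemialgHom.coe_mk] -/
@[simp]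
theorem SemialgHom.coe_mk (f : A →ₛₗ[φ] B) (h₁ h₂ h₃) : ((⟨f, h₁, h₂, h₃⟩ : A →ₛₐ[φ] B) : A → B) = f :=
  rfl

end Literature.NumberTheory.AdelicBaseChange

end semialghom

section semialghomclass

namespace Literature.NumberTheory.AdelicBaseChange

/-- `SemialgHomClass F φ A B` states that `F` is a type of `φ`-semialgebra homomorphisms
from `A` to `B`, where `A` is an `R`-algebra, `B` is an `S`-algebra and `φ : R →+* S`.
[cite: FLTProject2025, FLT/Mathlib/Algebra/Algebra/Hom.lean · SemialgHomClass] -/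
class SemialgHomClass (F : Type*) {R S : outParam Type*}
  [CommSemiring R] [CommSemiring S] (φ : outParam (R →+* S)) (A B : outParam Type*)
  [Semiring A] [Semiring B] [Algebra R A] [Algebra S B]
  [FunLike F A B] extends SemilinearMapClass F φ A B, RingHomClass F A B

end Literature.NumberTheory.AdelicBaseChange

variable (F : Type*) {R S : Type*}
  [CommSemiring R] [CommSemiring S] (φ : R →+* S) (A B : outParam Type*)
  [Semiring A] [Semiring B] [Algebra R A] [Algebra S B]
  [FunLike F A B] [SemialgHomClass F φ A B]

namespace Literature.NumberTheory.AdelicBaseChange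

/-- `A →ₛₐ[φ] B` itself satisfies `SemialgHomClass`.
[cite: FLTProject2025, FLT/Mathlib/Algebra/Algebra/Hom.lean · SemialgHomClass.instSemialgHom] -/
instance SemialgHomClass.instSemialgHom : SemialgHomClass (A →ₛₐ[φ] B) φ A B where
  map_add ψ := ψ.map_add
  map_smulₛₗ ψ := ψ.map_smulₛₗ
  map_mul ψ := ψ.map_mul
  map_one ψ := ψ.map_one
  map_zero ψ := ψ.map_zero

variable {F} {φ} {A} {B} in
/-- Turn an element of `F` which satisfies `SemialgHomClass F φ A B` to a `SemialgHom`.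
[cite: FLTProject2025, FLT/Mathlib/Algebra/Algebra/Hom.lean · SemialgHomClass.toSemialgHom] -/
def SemialgHomClass.toSemialgHom (f : F) : A →ₛₐ[φ] B :=
  { (f : A →ₛₗ[φ] B), (f : A →+* B) with }

/-- Coercion from a `SemialgHomClass` type `F` to `A →ₛₐ[φ] B`. -/
instance : CoeTC F (A →ₛₐ[φ] B) :=
  ⟨SemialgHomClass.toSemialgHom⟩

/-- The coercion `F → (A →ₛₐ[φ] B)` does not change the underlying function.
[cite: FLTProject2025, FLT/Mathlib/Algebra/Algebra/Hom.lean · SemialgHom.coe_coe] -/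
@[simp]
theorem SemialgHom.coe_coe (f : F) : ⇑(f : A →ₛₐ[φ] B) = f :=
  rfl

end Literature.NumberTheory.AdelicBaseChange

end semialghomclass

section semialghom

variable {R S : Type*} [CommSemiring R] [CommSemiring S] {φ : R →+* S}
    {A B : Type*} [Semiring A] [Semiring B] [Algebra R A] [Algebra S B]

namespace Literature.NumberTheory.AdelicBaseChange

/-- A `φ`-semialgebra hom lies over `φ` on the structure maps: `ψ (algebraMap R A r) = algebraMap S
B (φ r)`. [cite: FLTProject2025, FLT/Mathlib/Algebra/Algebra/Hom.lean · SemialgHom.commutes] -/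
lemma SemialgHom.commutes (ψ : A →ₛₐ[φ] B) (r : R) :
    ψ (algebraMap R A r) = algebraMap S B (φ r) := by
  have := ψ.map_smul r 1
  rw [Algebra.smul_def, mul_one, map_one] at this
  rw [this, Algebra.smul_def, mul_one]

/-- The semilinear map underlying `f : A →ₛₐ[φ] B` coerces to `f`.
[cite: FLTProject2025, FLT/Mathlib/Algebra/Algebra/Hom.lean · SemialgHom.toLinearMap_eq_coe] -/
theorem SemialgHom.toLinearMap_eq_coe (f : A →ₛₐ[φ] B) : f.toLinearMap = f :=
  rfl

/-- The ring hom underlying `f : A →ₛₐ[φ] B` coerces to `f`.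
[cite: FLTProject2025, FLT/Mathlib/Algebra/Algebra/Hom.lean · SemialgHom.toRingHom_eq_coe] -/
theorem SemialgHom.toRingHom_eq_coe (f : A →ₛₐ[φ] B) : f.toRingHom = f :=
  rfl

/-- With the algebra structure `f.toAlgebra` on `B` over `A`, `algebraMap A B = f`.
[cite: FLTProject2025, FLT/Mathlib/Algebra/Algebra/Hom.lean · SemialgHom.algebraMap_apply] -/
theorem SemialgHom.algebraMap_apply {A B : Type*} [CommSemiring A] [CommSemiring B]
    [Algebra R A] [Algebra S B] (f : A →ₛₐ[φ] B) (a : A) :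
    letI := f.toAlgebra
    algebraMap A B a = f a := rfl

/-- The composition of two semi-algebra maps.
[cite: FLTProject2025, FLT/Mathlib/Algebra/Algebra/Hom.lean · SemialgHom.comp] -/
def SemialgHom.comp {T : Type*} [CommSemiring T] {C : Type*} [Semiring C]
    [Algebra T C] {ψ : S →+* T} {ξ : R →+* T} [RingHomCompTriple φ ψ ξ]
    (g : B →ₛₐ[ψ] C) (f : A →ₛₐ[φ] B) :
    A →ₛₐ[ξ] C where
  __ := LinearMap.comp (SemialgHom.toLinearMap g) (SemialgHom.toLinearMap f)
  __ := RingHom.comp g.toRingHom f.toRingHom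

end Literature.NumberTheory.AdelicBaseChange

/-- An algebra map defines a semi-algebra map using `RingHom.id`
(In Mathlib's namespace `AlgHom`: a deliberate extension under FLT's name, for dot notation and so
that the later packet files apply unchanged — CONVENTIONS §2.)
[cite: FLTProject2025, FLT/Mathlib/Algebra/Algebra/Hom.lean · AlgHom.toSemialgHom] -/
def AlgHom.toSemialgHom {R : Type*} [CommSemiring R] {A B : Type*} [Semiring A] [Semiring B]
    [Algebra R A] [Algebra R B] (f : A →ₐ[R] B) :
    A →ₛₐ[RingHom.id R] B where
  __ := f
  map_smul' _ _ := by simp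

/-- Promote a ring hom `f : A →+* B` which is `φ`-semilinear to a semi-algebra map.

This is *definitionally* `f` on the underlying ring hom, so any definitional equality satisfied
by `f` is inherited by the result. Use this in preference to transporting a semi-algebra map
along equivalences of `A` and `B`, which does not preserve such equalities.
(In Mathlib's namespace `RingHom`: a deliberate extension under FLT's name, for dot notation and so
that the later packet files apply unchanged — CONVENTIONS §2.)
[cite: FLTProject2025, FLT/Mathlib/Algebra/Algebra/Hom.lean · RingHom.toSemialgHom] -/
def RingHom.toSemialgHom (f : A →+* B) (h : ∀ (r : R) (a : A), f (r • a) = φ r • f a) :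
    A →ₛₐ[φ] B where
  __ := f
  map_smul' := h

/-- The function underlying `RingHom.toSemialgHom f h` is `f`.
(In Mathlib's namespace `RingHom`: a deliberate extension under FLT's name, for dot notation and so
that the later packet files apply unchanged — CONVENTIONS §2.)
[cite: FLTProject2025, FLT/Mathlib/Algebra/Algebra/Hom.lean · RingHom.coe_toSemialgHom] -/
@[simp]
theorem RingHom.coe_toSemialgHom (f : A →+* B) (h : ∀ (r : R) (a : A), f (r • a) = φ r • f a) :
    ⇑(RingHom.toSemialgHom f h) = ⇑f :=
  rfl

namespace Literature.NumberTheory.AdelicBaseChange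

/-- The composition `(B →ₛₐ[ψ] C) ∘ (A →ₐ[S] B) → `A →ₛₐ[ψ] C` of a semi-algebra map with an
algebra map to give a semi-algebra map.
[cite: FLTProject2025, FLT/Mathlib/Algebra/Algebra/Hom.lean · SemialgHom.compAlgHom] -/
def SemialgHom.compAlgHom {T : Type*} [CommSemiring T] {C : Type*} [Semiring C]
    [Algebra T C] {ψ : S →+* T} [Algebra S A] (g : B →ₛₐ[ψ] C) (f : A →ₐ[S] B) :
    A →ₛₐ[ψ] C :=
  g.comp f.toSemialgHom

/-- The product of two semi-algebra maps on the same domain.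
[cite: FLTProject2025, FLT/Mathlib/Algebra/Algebra/Hom.lean · SemialgHom.prod] -/
def SemialgHom.prod {C : Type*} [Semiring C] [Algebra S C] (f : A →ₛₐ[φ] B)
    (g : A →ₛₐ[φ] C) :
    A →ₛₐ[φ] B × C where
  __ := RingHom.prod f.toRingHom g.toRingHom
  map_smul' r x := by simp

/-- The product of two semi-algebra maps on separate domains.
[cite: FLTProject2025, FLT/Mathlib/Algebra/Algebra/Hom.lean · SemialgHom.prodMap] -/
def SemialgHom.prodMap {C D : Type*} [Semiring C] [Semiring D]
    [Algebra S C] [Algebra S D] [Algebra R B] (f : A →ₛₐ[φ] C) (g : B →ₛₐ[φ] D) :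
    A × B →ₛₐ[φ] C × D :=
  (f.compAlgHom (AlgHom.fst R A B)).prod (g.compAlgHom (AlgHom.snd R A B))

/-- Restrict the scalars of semialgebra map `f : A →ₛₐ[ψ] B` where `ψ : R' →ₛₐ[φ] S'`, to
`φ : R →+* S`.
[cite: FLTProject2025, FLT/Mathlib/Algebra/Algebra/Hom.lean · SemialgHom.restrictScalars] -/
@[simps!]
def SemialgHom.restrictScalars {R S R' S' : Type*} [CommSemiring R] [CommSemiring S]
    [CommSemiring R'] [CommSemiring S'] [Algebra R R'] [Algebra S S'] {φ : R →+* S}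
    (ψ : R' →ₛₐ[φ] S') {A B : Type*} [Semiring A] [Semiring B] [Algebra R A] [Algebra S B]
    [Algebra R' A] [Algebra S' B] [IsScalarTower R R' A] [IsScalarTower S S' B]
    (f : A →ₛₐ[ψ.toRingHom] B) : A →ₛₐ[φ] B where
  __ := f.toRingHom
  map_smul' r a := by
    have := f.map_smul (algebraMap R R' r) a
    simp_all [SemialgHom.toLinearMap_eq_coe, Algebra.algebraMap_eq_smul_one, ψ.map_smul]

end Literature.NumberTheory.AdelicBaseChange

end semialghom

/-! ## From `FLT/Mathlib/Algebra/Algebra/Pi.lean` -/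

/-- A family of semialgebra homomorphisms `g i : A →ₛₐ[φ] f i` defines a single
semialgebra homomorphism `A →ₛₐ[φ] (i : I) → f i` to the product algebra.
(In Mathlib's namespace `Pi`: a deliberate extension under FLT's name, for dot notation and so that
the later packet files apply unchanged — CONVENTIONS §2.)
[cite: FLTProject2025, FLT/Mathlib/Algebra/Algebra/Pi.lean · Pi.semialgHom] -/
def Pi.semialgHom {I : Type*} {R S : Type*} (f : I → Type*) [CommSemiring R] [CommSemiring S]
    (φ : R →+* S) [s : (i : I) → Semiring (f i)] [(i : I) → Algebra S (f i)] {A : Type*}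
    [Semiring A] [Algebra R A] (g : (i : I) → A →ₛₐ[φ] f i) :
    A →ₛₐ[φ] (i : I) → f i where
  __ := RingHom.pi fun i ↦ (g i).toRingHom
  map_smul' r a := by ext; simp

/-- Componentwise evaluation of `Pi.semialgHom`: `(Pi.semialgHom f φ g) a i = g i a`.
(In Mathlib's namespace `Pi`: a deliberate extension under FLT's name, for dot notation and so that
the later packet files apply unchanged — CONVENTIONS §2.)
[cite: FLTProject2025, FLT/Mathlib/Algebra/Algebra/Pi.lean · Pi.semialgHom_apply] -/
@[simp]
theorem Pi.semialgHom_apply {I : Type*} {R S : Type*} (f : I → Type*) [CommSemiring R]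
    [CommSemiring S]
    (φ : R →+* S) [s : (i : I) → Semiring (f i)] [(i : I) → Algebra S (f i)] {A : Type*}
    [Semiring A] [Algebra R A] (g : (i : I) → A →ₛₐ[φ] f i) (a : A) (i : I) :
    (Pi.semialgHom _ φ g) a i = g i a :=
  rfl

/-- Given a reindexing `r : I → J` and a family of semialgebra homs
`p i : g (r i) →ₛₐ[φ] f i`, build a semialgebra hom from the product over `J` of the `g j` to
the product over `I` of the `f i`.
(In Mathlib's namespace `Pi`: a deliberate extension under FLT's name, for dot notation and so that
the later packet files apply unchanged — CONVENTIONS §2.)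
[cite: FLTProject2025, FLT/Mathlib/Algebra/Algebra/Pi.lean · Pi.semialgHomPi] -/
def Pi.semialgHomPi {I J : Type*} {R S : Type*} (f : I → Type*)
    (g : J → Type*) [CommSemiring R] [CommSemiring S] {φ : R →+* S}
    [(i : I) → Semiring (f i)] [(i : I) → Algebra S (f i)] [(j : J) → Semiring (g j)]
    [(j : J) → Algebra R (g j)] {r : I → J} (p : (i : I) → g (r i) →ₛₐ[φ] f i) :
    ((j : J) → g j) →ₛₐ[φ] (i : I) → f i where
  toFun x w := p w (x (r w))
  map_one' := by simp [Pi.one_def]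
  map_mul' x y := funext fun w => by simp [map_mul]
  map_zero' := by simp [Pi.zero_def]
  map_add' x y := funext fun w => by simp [map_add]
  map_smul' k x := funext fun w => (p w).map_smul' k (x (r w))

/-- Componentwise evaluation of `Pi.semialgHomPi`: the `i`-th component is `p i (a (r i))`.
(In Mathlib's namespace `Pi`: a deliberate extension under FLT's name, for dot notation and so that
the later packet files apply unchanged — CONVENTIONS §2.)
[cite: FLTProject2025, FLT/Mathlib/Algebra/Algebra/Pi.lean · Pi.semialgHomPi_apply] -/
@[simp]
theorem Pi.semialgHomPi_apply {I J : Type*} {R S : Type*} (f : I → Type*)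
    (g : J → Type*) [CommSemiring R] [CommSemiring S] {φ : R →+* S}
    [(i : I) → Semiring (f i)] [(i : I) → Algebra S (f i)] [(j : J) → Semiring (g j)]
    [(j : J) → Algebra R (g j)] {r : I → J} (p : (i : I) → g (r i) →ₛₐ[φ] f i)
    (a : (j : J) → g j) (i : I) :
    Pi.semialgHomPi _ _ p a i = p i (a (r i)) := rfl

/-- Let `f : α → β` be a function on index types. A family of `R`-algebra equivalences, indexed by
`b : β`, between the product over the fiber of `b` under `f` given as
`∀ (σ : { a : α // f a = b }) → γ₁ σ.1) ≃ₐ[R] γ₂ b` lifts to an equivalence over the products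
`∀ a, γ₁ a ≃ₐ[R] ∀ b, γ₂ b`. This is `Equiv.piCongrFiberwise` as an `AlgEquiv`.
(In Mathlib's namespace `AlgEquiv`: a deliberate extension under FLT's name, for dot notation and
so that the later packet files apply unchanged — CONVENTIONS §2.)
[cite: FLTProject2025, FLT/Mathlib/Algebra/Algebra/Pi.lean · AlgEquiv.piCongrFiberwise] -/
def AlgEquiv.piCongrFiberwise {α : Type*} {β : Type*} {R : Type*} {γ₁ : α → Type*} {γ₂ : β → Type*}
    {f : α → β} [CommSemiring R] [(a : α) → Semiring (γ₁ a)] [(b : β) → Semiring (γ₂ b)]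
    [(a : α) → Algebra R (γ₁ a)] [(b : β) → Algebra R (γ₂ b)]
    (e : (b : β) → ((x : { x : α // f x = b }) → γ₁ x.1) ≃ₐ[R] γ₂ b) :
    ((a : α) → γ₁ a) ≃ₐ[R] ((b : β) → γ₂ b) where
  __ := Equiv.piCongrFiberwise fun _ => (e _).toEquiv
  map_add' _ _ := by funext b; simp [← Pi.add_def]
  map_mul' _ _ := by funext b; simp [← Pi.mul_def]
  commutes' r := by funext b; simp [← (e b).commutes' r, Pi.algebraMap_def]

/-- A ring hom from a finite product of rings to a nontrivial ring does not kill all the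
idempotents `Pi.single i 1`.
(In Mathlib's namespace `RingHom`: a deliberate extension under FLT's name, for dot notation and so
that the later packet files apply unchanged — CONVENTIONS §2.)
[cite: FLTProject2025, FLT/Mathlib/Algebra/Algebra/Pi.lean · RingHom.exists_map_single_ne_zero] -/
lemma RingHom.exists_map_single_ne_zero
    {ι S : Type*} {R : ι → Type*} [_root_.Finite ι] [DecidableEq ι]
    [∀ i, Semiring (R i)] [Semiring S] [Nontrivial S] (f : (Π i, R i) →+* S) :
    ∃ i, f (Pi.single i 1) ≠ 0 := by
  cases nonempty_fintype ι
  by_contra! H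
  simpa [H] using DFunLike.congr_arg f (Finset.univ_sum_single 1)

/-- Given a map from a product of rings to a nontrivial ring, this is an arbitrary index whose
corresponding component is not sent to zero.
(In Mathlib's namespace `RingHom`: a deliberate extension under FLT's name, for dot notation and so
that the later packet files apply unchanged — CONVENTIONS §2.)
[cite: FLTProject2025, FLT/Mathlib/Algebra/Algebra/Pi.lean · RingHom.piIndex] -/
noncomputable
def RingHom.piIndex {ι S : Type*} {R : ι → Type*} [_root_.Finite ι] [DecidableEq ι]
    [∀ i, Semiring (R i)] [Semiring S] [Nontrivial S] (f : (Π i, R i) →+* S) : ι :=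
  f.exists_map_single_ne_zero.choose

/-- The idempotent `Pi.single f.piIndex 1` is not sent to zero by `f`.
(In Mathlib's namespace `RingHom`: a deliberate extension under FLT's name, for dot notation and so
that the later packet files apply unchanged — CONVENTIONS §2.)
[cite: FLTProject2025, FLT/Mathlib/Algebra/Algebra/Pi.lean · RingHom.single_piIndex_ne_zero] -/
lemma RingHom.single_piIndex_ne_zero {ι S : Type*} {R : ι → Type*} [_root_.Finite ι] [DecidableEq ι]
    [∀ i, Semiring (R i)] [Semiring S] [Nontrivial S] (f : (Π i, R i) →+* S) :
    f (Pi.single f.piIndex 1) ≠ 0 :=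
  f.exists_map_single_ne_zero.choose_spec

/-- If the target is a domain, `f (Pi.single f.piIndex 1) = 1`.
(In Mathlib's namespace `RingHom`: a deliberate extension under FLT's name, for dot notation and so
that the later packet files apply unchanged — CONVENTIONS §2.)
[cite: FLTProject2025, FLT/Mathlib/Algebra/Algebra/Pi.lean · RingHom.single_piIndex_one] -/
@[simp]
lemma RingHom.single_piIndex_one {ι S : Type*} {R : ι → Type*} [_root_.Finite ι] [DecidableEq ι]
    [∀ i, Semiring (R i)] [Semiring S] [IsDomain S] (f : (Π i, R i) →+* S) :
    f (Pi.single f.piIndex 1) = 1 :=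
  mul_left_injective₀ f.single_piIndex_ne_zero (by simp [← map_mul, ← Pi.single_mul])

/-- If the target is a domain, `f` only depends on the `f.piIndex`-component: `f (Pi.single
f.piIndex (x _)) = f x`.
(In Mathlib's namespace `RingHom`: a deliberate extension under FLT's name, for dot notation and so
that the later packet files apply unchanged — CONVENTIONS §2.)
[cite: FLTProject2025, FLT/Mathlib/Algebra/Algebra/Pi.lean · RingHom.single_piIndex] -/
@[simp]
lemma RingHom.single_piIndex {ι S : Type*} {R : ι → Type*} [_root_.Finite ι] [DecidableEq ι]
    [∀ i, Semiring (R i)] [Semiring S] [IsDomain S] (f : (Π i, R i) →+* S) (x : Π i, R i) :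
    f (Pi.single f.piIndex (x _)) = f x := by
  conv_rhs => rw [← one_mul (f x), ← f.single_piIndex_one, ← f.map_mul]
  rw [← Pi.single_mul_left, one_mul]

/-- `Pi.single` as a `NonUnitalRingHom`.
(In Mathlib's namespace `NonUnitalRingHom`: a deliberate extension under FLT's name, for dot
notation and so that the later packet files apply unchanged — CONVENTIONS §2.)
[cite: FLTProject2025, FLT/Mathlib/Algebra/Algebra/Pi.lean · NonUnitalRingHom.single] -/
noncomputable
def NonUnitalRingHom.single {ι : Type*} (R : ι → Type*) [DecidableEq ι]
    [∀ i, NonUnitalNonAssocSemiring (R i)] (i) : R i →ₙ+* Π i, R i where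
  __ := AddMonoidHom.single R i
  map_mul' _ _ := Pi.single_mul _ _ _

/-- `NonUnitalRingHom.single R i x = Pi.single i x`.
(In Mathlib's namespace `NonUnitalRingHom`: a deliberate extension under FLT's name, for dot
notation and so that the later packet files apply unchanged — CONVENTIONS §2.)
[cite: FLTProject2025, FLT/Mathlib/Algebra/Algebra/Pi.lean · NonUnitalRingHom.single_apply] -/
@[simp]
lemma NonUnitalRingHom.single_apply {ι : Type*} {R : ι → Type*} [DecidableEq ι]
    [∀ i, NonUnitalNonAssocSemiring (R i)] (i : ι) (x : R i) : single R i x = Pi.single i x := rfl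

/-- Evaluation of `f.toNonUnitalRingHom` is evaluation of `f`.
(In Mathlib's namespace `RingHom`: a deliberate extension under FLT's name, for dot notation and so
that the later packet files apply unchanged — CONVENTIONS §2.)
[cite: FLTProject2025, FLT/Mathlib/Algebra/Algebra/Pi.lean · RingHom.toNonUnitalRingHom_apply] -/
@[simp]
lemma RingHom.toNonUnitalRingHom_apply {R S : Type*} [NonAssocSemiring R] [NonAssocSemiring S]
    (f : R →+* S) (x : R) : f.toNonUnitalRingHom x = f x := rfl

/-- A map from a product of rings to a domain must factor through one of the components.
This is the factor map.
(In Mathlib's namespace `RingHom`: a deliberate extension under FLT's name, for dot notation and so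
that the later packet files apply unchanged — CONVENTIONS §2.)
[cite: FLTProject2025, FLT/Mathlib/Algebra/Algebra/Pi.lean · RingHom.projPiIndex] -/
@[simps!]
noncomputable
def RingHom.projPiIndex {ι S : Type*} {R : ι → Type*} [_root_.Finite ι] [DecidableEq ι]
    [∀ i, Semiring (R i)] [Semiring S] [IsDomain S] (f : (Π i, R i) →+* S) :
    R f.piIndex →+* S where
  __ := f.toNonUnitalRingHom.comp (NonUnitalRingHom.single R f.piIndex)
  map_one' := by simp

/-- `Hom(∏ Rᵢ, S) ≃ ∐ Hom(Rᵢ, S)` when `S` is a domain.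
(In Mathlib's namespace `Pi`: a deliberate extension under FLT's name, for dot notation and so that
the later packet files apply unchanged — CONVENTIONS §2.)
[cite: FLTProject2025, FLT/Mathlib/Algebra/Algebra/Pi.lean · Pi.ringHomEquivOfIsDomain] -/
@[simps! apply_fst apply_snd symm_apply_apply]
noncomputable
def Pi.ringHomEquivOfIsDomain {ι S : Type*} {R : ι → Type*} [Finite ι] [DecidableEq ι]
    [∀ i, Ring (R i)] [Ring S] [IsDomain S] :
    ((Π i, R i) →+* S) ≃ Σ i, R i →+* S where
  toFun f := ⟨f.piIndex, f.projPiIndex⟩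
  invFun f := f.2.comp (Pi.evalRingHom R f.1)
  left_inv f := by ext; simp
  right_inv f := by
    have : Function.Injective (fun f : Σ i, R i →+* S ↦ f.2.comp (Pi.evalRingHom R f.1)) := by
      intro ⟨i₁, f₁⟩ ⟨i₂, f₂⟩ e
      obtain rfl : i₁ = i₂ := by
        by_contra H; simpa [H] using DFunLike.congr_fun e (Pi.single i₁ 1)
      congr 1
      ext x
      simpa using DFunLike.congr_fun e (Pi.single i₁ x)
    exact this (by ext; simp)

set_option backward.isDefEq.respectTransparency false in
/-- `Hom(∏ Rᵢ, S) ≃ ∐ Hom(Rᵢ, S)` when `S` is a domain.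
This is the `AlgHom` version of `Pi.ringHomEquivOfIsDomain`.
(In Mathlib's namespace `Pi`: a deliberate extension under FLT's name, for dot notation and so that
the later packet files apply unchanged — CONVENTIONS §2.)
[cite: FLTProject2025, FLT/Mathlib/Algebra/Algebra/Pi.lean · Pi.algHomEquivOfIsDomain] -/
@[simps! apply_fst symm_apply_apply, simps! -isSimp apply_snd_apply]
noncomputable
def Pi.algHomEquivOfIsDomain {ι R₀ S : Type*} {R : ι → Type*} [Finite ι] [DecidableEq ι]
    [CommSemiring R₀]
    [∀ i, Ring (R i)] [∀ i, Algebra R₀ (R i)] [Ring S] [Algebra R₀ S] [IsDomain S] :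
    ((Π i, R i) →ₐ[R₀] S) ≃ Σ i, (R i →ₐ[R₀] S) where
  toFun f := ⟨_, f.projPiIndex, fun r ↦ (f.single_piIndex _).trans (f.commutes r)⟩
  invFun f := f.2.comp (Pi.evalAlgHom R₀ R f.1)
  left_inv f := by ext; simp
  right_inv f := by
    let emb : (Σ i, (R i →ₐ[R₀] S)) → (Σ i, (R i →+* S)) := Sigma.map id fun _ ↦ AlgHom.toRingHom
    have : emb.Injective := Function.Injective.sigma_map (fun _ _ e ↦ e)
        fun _ a b e ↦ AlgHom.ext (DFunLike.congr_fun e :)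
    apply this
    exact Pi.ringHomEquivOfIsDomain.apply_symm_apply ⟨f.1, f.2.toRingHom⟩

/-! ## From `FLT/Mathlib/Topology/Algebra/UniformRing.lean` -/

namespace UniformSpace.Completion

variable {α : Type*} [Ring α] [UniformSpace α] [IsTopologicalRing α] [IsUniformAddGroup α]
  {β : Type*} [UniformSpace β] [Ring β] [IsUniformAddGroup β] [IsTopologicalRing β]
  (f : α →+* β) (hf : Continuous f)

variable {f}

/-- The semialgebra homomorphism `Completion α →ₛₐ[f] Completion β` induced from
a continuous ring homomorphism `f : α →+* β`.
(In Mathlib's namespace `UniformSpace.Completion`: a deliberate extension under FLT's name, for dot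
notation and so that the later packet files apply unchanged — CONVENTIONS §2.)
[cite: FLTProject2025, FLT/Mathlib/Topology/Algebra/UniformRing.lean · UniformSpace.Completion.mapSemialgHom] -/
noncomputable def mapSemialgHom {α : Type*} [CommRing α] [UniformSpace α]
    [IsTopologicalRing α] [IsUniformAddGroup α] {β : Type*} [UniformSpace β] [CommRing β]
    [IsUniformAddGroup β] [IsTopologicalRing β] (f : α →+* β) (hf : Continuous f) :
    Completion α →ₛₐ[f] Completion β where
  __ := UniformSpace.Completion.mapRingHom f hf
  map_smul' m x := by
    simp only [RingHom.toMonoidHom_eq_coe, OneHom.toFun_eq_coe, MonoidHom.toOneHom_coe,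
      MonoidHom.coe_coe]
    rw [Algebra.smul_def, map_mul, Algebra.smul_def]
    congr
    exact extensionHom_coe _ _ m

/-- `mapSemialgHom f hf` agrees with `UniformSpace.Completion.map f` on elements.
(In Mathlib's namespace `UniformSpace.Completion`: a deliberate extension under FLT's name, for dot
notation and so that the later packet files apply unchanged — CONVENTIONS §2.)
[cite: FLTProject2025, FLT/Mathlib/Topology/Algebra/UniformRing.lean · UniformSpace.Completion.mapSemialgHom_apply] -/
theorem mapSemialgHom_apply {α : Type*} [CommRing α] [UniformSpace α]
    [IsTopologicalRing α] [IsUniformAddGroup α] {β : Type*} [UniformSpace β] [CommRing β]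
    [IsUniformAddGroup β] [IsTopologicalRing β] (f : α →+* β) (hf : Continuous f)
    (x : UniformSpace.Completion α) :
    mapSemialgHom f hf x = UniformSpace.Completion.map f x := rfl

/-- `mapSemialgHom f _` extends `f`: on `a : α` it is `f a` (for uniformly continuous `f`).
(In Mathlib's namespace `UniformSpace.Completion`: a deliberate extension under FLT's name, for dot
notation and so that the later packet files apply unchanged — CONVENTIONS §2.)
[cite: FLTProject2025, FLT/Mathlib/Topology/Algebra/UniformRing.lean · UniformSpace.Completion.mapSemialgHom_coe] -/
theorem mapSemialgHom_coe {α : Type*} [CommRing α] [UniformSpace α]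
    [IsTopologicalRing α] [IsUniformAddGroup α] {β : Type*} [UniformSpace β] [CommRing β]
    [IsUniformAddGroup β] [IsTopologicalRing β] {f : α →+* β} (hf : UniformContinuous f)
    (a : α) :
    mapSemialgHom f hf.continuous a = f a := by
  rw [mapSemialgHom_apply, map_coe hf]

end UniformSpace.Completion

/-! ## From `FLT/Mathlib/Topology/Algebra/Algebra/Hom.lean` -/

namespace Literature.NumberTheory.AdelicBaseChange

/-- A `SemialgHom` (i.e., `ψ` such that `ψ (r • a) = φ r • ψ a` for some `φ : R →+* S`) that
is also continuous.
[cite: FLTProject2025, FLT/Mathlib/Topology/Algebra/Algebra/Hom.lean · ContinuousSemialgHom] -/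
structure ContinuousSemialgHom {R S : Type*} [CommSemiring R] [CommSemiring S]
    (φ : R →+* S) (A B : Type*) [TopologicalSpace A] [TopologicalSpace B]
    [Semiring A] [Semiring B] [Algebra R A] [Algebra S B]
    extends SemialgHom φ A B where
  continuous_toFun : Continuous toFun

@[inherit_doc ContinuousSemialgHom]
infixr:25 " →SA " => ContinuousSemialgHom _

@[inherit_doc]
notation:25 A " →SA[" φ:25 "] " B:0 => ContinuousSemialgHom φ A B

/-- `ContinuousSemialgHomClass F φ A B` states that `F` is the type of continuous semi-algebra
maps from `A` to `B` with respect to `φ`.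
[cite: FLTProject2025, FLT/Mathlib/Topology/Algebra/Algebra/Hom.lean · ContinuousSemialgHomClass] -/
class ContinuousSemialgHomClass (F : Type*) {R S : outParam Type*}
    [CommSemiring R] [CommSemiring S] (φ : outParam (R →+* S)) (A B : outParam Type*)
    [Semiring A] [Semiring B] [Algebra R A] [Algebra S B] [TopologicalSpace A] [TopologicalSpace B]
    [FunLike F A B] extends SemialgHomClass F φ A B where continuous_toFun (f : F) : Continuous f

namespace ContinuousSemialgHom

variable {R S : Type*} [CommSemiring R] [CommSemiring S] (φ : R →+* S)
    (A B : Type*) [Semiring A] [Semiring B] [Algebra R A] [Algebra S B]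
    [TopologicalSpace A] [TopologicalSpace B]

/-- `A →SA[φ] B` is a type of functions `A → B`.
[cite: FLTProject2025, FLT/Mathlib/Topology/Algebra/Algebra/Hom.lean · ContinuousSemialgHom.instFunLike] -/
instance instFunLike : FunLike (A →SA[φ] B) A B where
  coe f := f.toFun
  coe_injective f g h := by
    cases f
    cases g
    congr
    exact DFunLike.coe_injective h

/-- Forget continuity: coercion `(A →SA[φ] B) → (A →ₛₐ[φ] B)`. -/
instance : CoeOut (A →SA[φ] B) (A →ₛₐ[φ] B) :=
  ⟨fun f => f.toSemialgHom⟩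

variable (F : Type*) (A B : outParam Type*)
  [Semiring A] [Semiring B] [Algebra R A] [Algebra S B]
  [FunLike F A B] [TopologicalSpace A] [TopologicalSpace B] [ContinuousSemialgHomClass F φ A B]

/-- `A →SA[φ] B` itself satisfies `ContinuousSemialgHomClass`. -/
instance : ContinuousSemialgHomClass (A →SA[φ] B) φ A B where
  map_add ψ := ψ.map_add
  map_smulₛₗ ψ := ψ.map_smulₛₗ
  map_mul ψ := ψ.map_mul
  map_one ψ := ψ.map_one
  map_zero ψ := ψ.map_zero
  continuous_toFun ψ := ψ.continuous_toFun

variable {F} {φ} {A} {B} in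
/-- Turn an element of `F` which satisfies `ContinuousSemialgHomClass F φ A B` to a
`ContinuousSemialgHom`.
[cite: FLTProject2025, FLT/Mathlib/Topology/Algebra/Algebra/Hom.lean · ContinuousSemialgHomClass.toContinuousSemialgHom] -/
def _root_.Literature.NumberTheory.AdelicBaseChange.ContinuousSemialgHomClass.toContinuousSemialgHom (f : F) : A →SA[φ] B :=
  { (f : A →ₛₐ[φ] B) with continuous_toFun := ContinuousSemialgHomClass.continuous_toFun f }

/-- Coercion from a `ContinuousSemialgHomClass` type `F` to `A →SA[φ] B`. -/
instance : CoeTC F (A →SA[φ] B) :=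
  ⟨ContinuousSemialgHomClass.toContinuousSemialgHom⟩

/-- The coercion `F → (A →SA[φ] B)` does not change the underlying function.
[cite: FLTProject2025, FLT/Mathlib/Topology/Algebra/Algebra/Hom.lean · ContinuousSemialgHom.coe_coe] -/
@[simp]
theorem coe_coe (f : F) : ⇑(f : A →SA[φ] B) = f :=
  rfl

/-- The semialgebra hom underlying `f : A →SA[φ] B` coerces to `f`.
[cite: FLTProject2025, FLT/Mathlib/Topology/Algebra/Algebra/Hom.lean · ContinuousSemialgHom.toSemialgHom_eq_coe] -/
theorem toSemialgHom_eq_coe (f : A →SA[φ] B) : f.toSemialgHom = f :=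
  rfl

/-- The semilinear map underlying `f : A →SA[φ] B` coerces to `f`.
[cite: FLTProject2025, FLT/Mathlib/Topology/Algebra/Algebra/Hom.lean · ContinuousSemialgHom.toLinearMap_eq_coe] -/
@[simp]
theorem toLinearMap_eq_coe (f : A →SA[φ] B) : f.toLinearMap = f := by
  rfl

/-- The ring hom underlying `f : A →SA[φ] B` coerces to `f`.
[cite: FLTProject2025, FLT/Mathlib/Topology/Algebra/Algebra/Hom.lean · ContinuousSemialgHom.toRingHom_eq_coe] -/
@[simp]
theorem toRingHom_eq_coe (f : A →SA[φ] B) : f.toRingHom = f :=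
  rfl

/-- A continuous `φ`-semialgebra hom lies over `φ` on the structure maps.
[cite: FLTProject2025, FLT/Mathlib/Topology/Algebra/Algebra/Hom.lean · ContinuousSemialgHom.commutes] -/
theorem commutes (ψ : A →SA[φ] B) (r : R) :
    ψ (algebraMap R A r) = algebraMap S B (φ r) :=
  ψ.toSemialgHom.commutes r

/-- The product of two continuous semi-algebra isomorphisms on the same domain.
[cite: FLTProject2025, FLT/Mathlib/Topology/Algebra/Algebra/Hom.lean · ContinuousSemialgHom.prod] -/
def prod {C : Type*} [Semiring C] [Algebra S C] [TopologicalSpace C] (f : A →SA[φ] B)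
    (g : A →SA[φ] C) :
    A →SA[φ] B × C where
  __ := f.toSemialgHom.prod g.toSemialgHom
  continuous_toFun := f.continuous_toFun.prodMk g.continuous_toFun

variable {φ A B} in
/-- the product of two continuous semi-algebra isomorphisms on different domains.
[cite: FLTProject2025, FLT/Mathlib/Topology/Algebra/Algebra/Hom.lean · ContinuousSemialgHom.prodMap] -/
def prodMap {C D : Type*} [Semiring C] [Semiring D] [Algebra S C] [Algebra S D]
    [TopologicalSpace C] [TopologicalSpace D] [Algebra R B] (f : A →SA[φ] C) (g : B →SA[φ] D) :
    A × B →SA[φ] C × D where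
  __ := SemialgHom.prodMap f g
  continuous_toFun := Continuous.prodMap f.continuous_toFun g.continuous_toFun

end ContinuousSemialgHom

end Literature.NumberTheory.AdelicBaseChange
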